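import Summits.Ventures.PackingBounds.Configurations.ListConfig
import Summits.Ventures.PackingBounds.Kissing.DimensionFive

/-!
# The `D₅` root system as an explicit 40-point kissing configuration on `S⁴`: `κ(5) ≥ 40`

Framing: lottery ticket; floor = certified bounds/negative ranges. Venture `PackingBounds` (cell
`pub-packcert`, seat `pub-packcert-energy`) — the **attained side** for the kissing problem in dimension `5`.

`vecs` lists the `40` minimal vectors `±e_i ± e_j` of `D₅` (squared length `2`); the kernel checks
the distance distribution `-1, -1/2, 0, 1/2` with multiplicities `1, 12, 14, 12`, so the normalised
roots form a kissing configuration: **`κ(5) ≥ 40`** (`exists_kissing_40`), the classical lower bound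
(Korkine–Zolotareff / Conway–Sloane Table 1.2), to be read with the cell's kernel-checked upper bounds
(`Kissing.kissing_dim5_le_*` from the Delsarte LP, `ThreePointCert.K5` from the Bachoc–Vallentin SDP:
`κ(5) ≤ 45`; in print `κ(5) ≤ 44`, Machado–de Oliveira Filho 2018). Also the energy identity of the
configuration for every potential.

## References
* J. H. Conway, N. J. A. Sloane, *Sphere Packings, Lattices and Groups*, Ch. 1 Table 1.2, Ch. 4 §7. [`ConwaySloane1999`]
-/

namespace Summit.Ventures.PackingBounds.Config.KissingD5

open Finset Summit.Ventures.PackingBounds.Config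

set_option maxHeartbeats 4000000 in
/-- The `40` minimal vectors `±e_i ± e_j` (`i < j`) of `D₅`. [cite: ConwaySloane1999, Ch. 4 §7] -/
def vecs : List (List ℤ) := [
  [1, 1, 0, 0, 0],
  [1, -1, 0, 0, 0],
  [-1, 1, 0, 0, 0],
  [-1, -1, 0, 0, 0],
  [1, 0, 1, 0, 0],
  [1, 0, -1, 0, 0],
  [-1, 0, 1, 0, 0],
  [-1, 0, -1, 0, 0],
  [1, 0, 0, 1, 0],
  [1, 0, 0, -1, 0],
  [-1, 0, 0, 1, 0],
  [-1, 0, 0, -1, 0],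
  [1, 0, 0, 0, 1],
  [1, 0, 0, 0, -1],
  [-1, 0, 0, 0, 1],
  [-1, 0, 0, 0, -1],
  [0, 1, 1, 0, 0],
  [0, 1, -1, 0, 0],
  [0, -1, 1, 0, 0],
  [0, -1, -1, 0, 0],
  [0, 1, 0, 1, 0],
  [0, 1, 0, -1, 0],
  [0, -1, 0, 1, 0],
  [0, -1, 0, -1, 0],
  [0, 1, 0, 0, 1],
  [0, 1, 0, 0, -1],
  [0, -1, 0, 0, 1],
  [0, -1, 0, 0, -1],
  [0, 0, 1, 1, 0],
  [0, 0, 1, -1, 0],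
  [0, 0, -1, 1, 0],
  [0, 0, -1, -1, 0],
  [0, 0, 1, 0, 1],
  [0, 0, 1, 0, -1],
  [0, 0, -1, 0, 1],
  [0, 0, -1, 0, -1],
  [0, 0, 0, 1, 1],
  [0, 0, 0, 1, -1],
  [0, 0, 0, -1, 1],
  [0, 0, 0, -1, -1]]

/-- The distance table: dot products of a member with the other members, with multiplicities. -/
def table : List (ℤ × ℕ) := [(-2, 1), (-1, 12), (0, 14), (1, 12)]

/-- Kernel check: `40` coordinate lists. -/
theorem length_vecs : vecs.length = 40 := by decide +kernel

set_option maxRecDepth 100000 in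
/-- Kernel check: every list has length `5` and the prescribed squared length. -/
private theorem shape_vecs : shapeOK vecs 5 (2 : ℤ) = true := by decide +kernel

/-- Kernel check: the table keys are distinct and differ from the squared length. -/
private theorem keys_table : keysOK table (2 : ℤ) = true := by decide +kernel

set_option maxRecDepth 100000 in
/-- Kernel check (the distance distribution): the dot products of every member with the other members
have exactly the tabulated multiplicities and take no other value. -/
private theorem hist_vecs : histOK vecs table vecs = true := by decide +kernel

/-- The coordinate lists are pairwise distinct (from the checks). -/
private theorem nodup_vecs : vecs.Nodup := nodup_of_checks shape_vecs keys_table hist_vecs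


/-- The configuration: the normalised coordinate lists as points of `ℝ^5`. -/
noncomputable def pts : Finset (EuclideanSpace ℝ (Fin 5)) := config (Int.castRingHom ℝ) 5 (2 : ℤ) vecs

/-- `ι q > 0`. -/
private theorem hq : 0 < (Int.castRingHom ℝ) (2 : ℤ) := by simp

/-- `pts` has `40` points. -/
theorem card_pts : pts.card = 40 := by
  rw [pts, card_eq Int.cast_injective hq shape_vecs keys_table hist_vecs nodup_vecs, length_vecs]

/-- Every point of `pts` is a unit vector. -/
private theorem norm_pts : ∀ x ∈ pts, ‖x‖ = 1 := norm_eq_one hq shape_vecs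

/-- Distinct points of `pts` have inner product `ι d / ι q` for a key `d` of the table. -/
private theorem inner_pts : ∀ x ∈ pts, ∀ y ∈ pts, x ≠ y → ∃ p ∈ table, inner ℝ x y = (Int.castRingHom ℝ) p.1 / (Int.castRingHom ℝ) (2 : ℤ) :=
  inner_mem hq shape_vecs hist_vecs

/-- **Energy of the configuration**: for every potential `a`, `Σ_{x ≠ y ∈ pts} a(⟪x,y⟫)` equals the
tabulated value. -/
theorem energy_pts (a : ℝ → ℝ) :
    ∑ x ∈ pts, ∑ y ∈ pts.erase x, a (inner ℝ x y) =
      (40 : ℝ) * (a (-1) + 12 * a (-1 / 2) + 14 * a 0 + 12 * a (1 / 2)) := by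
  rw [pts, energy_eq Int.cast_injective hq shape_vecs keys_table hist_vecs nodup_vecs a, length_vecs]
  simp only [table, List.map_cons, List.map_nil, List.sum_cons, List.sum_nil, Nat.cast_ofNat, Nat.cast_one]
  norm_num
  ring

/-- Distinct points of `pts` have inner product `≤ 1 / 2`. -/
private theorem inner_pts_le : ∀ x ∈ pts, ∀ y ∈ pts, x ≠ y → inner ℝ x y ≤ 1 / 2 := by
  refine inner_le hq shape_vecs hist_vecs (1 / 2) fun p hp => ?_
  simp only [table, List.mem_cons, List.not_mem_nil, or_false] at hp
  rcases hp with rfl | rfl | rfl | rfl <;> norm_num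

/-- **`κ(5) ≥ 40`, attained side**: `40` unit vectors of `ℝ⁵` with pairwise inner products `≤ 1/2` (the `D₅` roots). [cite: ConwaySloane1999, Ch. 1 Table 1.2] -/
theorem exists_kissing_40 : ∃ C : Finset (EuclideanSpace ℝ (Fin 5)),
    C.card = 40 ∧ (∀ x ∈ C, ‖x‖ = 1) ∧ (∀ x ∈ C, ∀ y ∈ C, x ≠ y → inner ℝ x y ≤ 1 / 2) :=
  ⟨pts, card_pts, norm_pts, inner_pts_le⟩

/-- **Energy value of the `D₅` kissing configuration**: for every potential `a` there is a `40`-point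
configuration on `S⁴` with `a`-energy `40 (a(-1) + 12 a(-1/2) + 14 a(0) + 12 a(1/2))`. -/
theorem exists_energy_40 (a : ℝ → ℝ) : ∃ C : Finset (EuclideanSpace ℝ (Fin 5)),
    (∀ x ∈ C, ‖x‖ = 1) ∧ C.card = 40 ∧
      ∑ x ∈ C, ∑ y ∈ C.erase x, a (inner ℝ x y) =
        (40 : ℝ) * (a (-1) + 12 * a (-1 / 2) + 14 * a 0 + 12 * a (1 / 2)) :=
  ⟨pts, norm_pts, card_pts, energy_pts a⟩

/-- **`40 ≤ κ(5) ≤ 46` in Lean** (attained: `D₅`; upper: the kernel-checked Delsarte LP certificate of the cell; the kernel SDP row `ThreePointCert.K5` gives `45`). [cite: ConwaySloane1999, Ch. 1 Table 1.2] -/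
theorem kissing_dim5_bounds :
    40 ∈ {N : ℕ | ∃ C : Finset (EuclideanSpace ℝ (Fin 5)), C.card = N ∧ (∀ x ∈ C, ‖x‖ = 1) ∧
      (∀ x ∈ C, ∀ y ∈ C, x ≠ y → inner ℝ x y ≤ 1 / 2)} ∧
    ∀ N ∈ {N : ℕ | ∃ C : Finset (EuclideanSpace ℝ (Fin 5)), C.card = N ∧ (∀ x ∈ C, ‖x‖ = 1) ∧
      (∀ x ∈ C, ∀ y ∈ C, x ≠ y → inner ℝ x y ≤ 1 / 2)}, N ≤ 46 := by
  refine ⟨exists_kissing_40, ?_⟩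
  rintro N ⟨C, rfl, h1, h2⟩
  exact Kissing.kissing_dim5_le_46 C h1 h2

end Summit.Ventures.PackingBounds.Config.KissingD5
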